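import Summits.CriticalPhenomena.PercolationContinuityZ3.Theorems.PercNearOneGluingNoHeavyLowerTailQuantitativeCovDIsolatedFloor
import Summits.CriticalPhenomena.PercolationContinuityZ3.Theorems.PercNearOneGluingNoHeavyLowerTailQuantitativeS5FloorExplicitCyl
import HarnessLib

/-!
# A LOCAL explicit floor for the conditioned vdBHK covariance: `covD(f; u) ≥ μ(D)·h_min·(p₀(1−p₀))^{|R|+1}·J`

Support file (`--supports stmt-CriticalPhenomena-4575`), prover seat `prim-rate-mine-2` (lane prim-rate, constants-miner (c), BENCH rows
M2-R49 / M2-R50; `run/shared/lean/prim/prim-rate/prim-rate-mine-2/PROOFS.md` §P50).  No definitions, no named facts, no sorries; standard axioms.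

Composition of the quantitative vdBHK floor `CSH.covD_ge_isolated` (row M2-R50, lower half:
`covD ≥ μ(D)·∏_{e∩Y≠∅}(1−w_e)·Cov_{w_Y}(f(𝒞_x), 1{x↔u})`) with the two-cylinder floor `QuantHarris.cov_ge_prodPow_cyl_mul_jumps` (row M2-R49) at the
zeroed weights `w_Y` (support `E_Y` = the pairs of `E` missing `Y`):
* `CSH.covD_ge_explicit_cyl` — weights `w = 0` off `E`, `p₀ ≤ w ≤ 1 − p₀` on `E` (`0 < p₀`); `x ∉ Y`; a pair `e ∈ E` missing `Y`; cylinder witnesses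
  `(R₁, η₁)` (an `f(𝒞_x)`-jump `≥ J ≥ 0` at `e`) and `(R₂, η₂)` (`e` pivotal for `{x ↔ u}`) over the configurations INSIDE `E_Y`, `R₁ ∪ R₂ ⊆ R ⊆ E_Y ∖ e`:
  **`μ(D) · ∏_{g : ∃ y ∈ Y, y ∈ g}(1 − w_g) · (p₀(1−p₀))^{|R|+1} · J ≤ covD w x Y f u`** — the third piece of the GEN identity (certificate C3) with an
  explicit constant that depends on the witness cylinders and the pairs at `Y`, not on `|E|`.
[cite: VandenbergHaggstromKahn2005, Thm. 1.3 (p. 6)] [cite: Harris1960, Lemma 4.1 (p. 16)] [cite: Talagrand1996, Thm. 1.1 (p. 244)]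
-/

noncomputable section

namespace Summit.CriticalPhenomena.PercolationContinuityZ3.Theorems

open MeasureTheory Set Literature.Probability.LatticeModels Literature.Probability.Percolation
open scoped Classical
open KNPreFKG

namespace CSH

variable {n : ℕ}

/-- **Local explicit floor for `covD` (cylinder witnesses).**  See the module docstring.
[cite: VandenbergHaggstromKahn2005, Thm. 1.3 (p. 6)] [cite: Harris1960, Lemma 4.1 (p. 16)] -/
theorem covD_ge_explicit_cyl (w : Sym2 (Fin n) → unitInterval) (E : Finset (Sym2 (Fin n))) (p₀ : ℝ) (hp0 : 0 < p₀)
    (hE0 : ∀ f, f ∉ E → (w f : ℝ) = 0) (hE1 : ∀ f ∈ E, p₀ ≤ (w f : ℝ) ∧ (w f : ℝ) ≤ 1 - p₀)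
    (x : Fin n) (Y : Set (Fin n)) (hxY : x ∉ Y) (u : Fin n)
    (f : Set (Sym2 (Fin n)) → ℝ) (hf : Monotone f) (hf0 : ∀ C, 0 ≤ f C)
    (e : Sym2 (Fin n)) (heE : e ∈ E) (heY : ∀ y ∈ Y, y ∉ e)
    (R R₁ R₂ : Finset (Sym2 (Fin n)))
    (hR : ∀ g ∈ R, g ∈ E ∧ g ≠ e ∧ ∀ y ∈ Y, y ∉ g) (hR₁ : R₁ ⊆ R) (hR₂ : R₂ ⊆ R)
    (η₁ η₂ : Set (Sym2 (Fin n))) (J : ℝ) (hJ : 0 ≤ J)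
    (hc₁ : ∀ ω : Set (Sym2 (Fin n)), ω ⊆ ↑(E.filter (fun g => ∀ y ∈ Y, y ∉ g)) → (∀ g ∈ R₁, (g ∈ ω ↔ g ∈ η₁)) →
      J ≤ f (openEdgeCluster (insert e ω) x) - f (openEdgeCluster (ω \ {e}) x))
    (hc₂ : ∀ ω : Set (Sym2 (Fin n)), ω ⊆ ↑(E.filter (fun g => ∀ y ∈ Y, y ∉ g)) → (∀ g ∈ R₂, (g ∈ ω ↔ g ∈ η₂)) →
      insert e ω ∈ (openConn x u : Set (BondConfig (Fin n))) ∧ ω \ {e} ∉ (openConn x u : Set (BondConfig (Fin n)))) :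
    (prodBernoulli w).real {ω : BondConfig (Fin n) | ∀ y ∈ Y, ¬ (openGraph ω).Reachable x y} *
        (∏ g ∈ Finset.univ.filter (fun g : Sym2 (Fin n) => ∃ y ∈ Y, y ∈ g), (1 - (w g : ℝ))) *
        ((p₀ * (1 - p₀)) ^ (R.card + 1) * J) ≤
      covD w x Y f u := by
  have hmeas : ∀ S : Set (BondConfig (Fin n)), MeasurableSet S := fun _ => MeasurableSet.of_discrete
  have hiso := covD_ge_isolated w x Y hxY u f hf hf0
  set qY : Sym2 (Fin n) → unitInterval := fun g => if (∃ y ∈ Y, y ∈ g) then (0 : unitInterval) else w g with hqY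
  set EY : Finset (Sym2 (Fin n)) := E.filter (fun g => ∀ y ∈ Y, y ∉ g) with hEY
  set U : Set (BondConfig (Fin n)) := openConn x u with hU
  set F : BondConfig (Fin n) → ℝ := fun ζ => f (openEdgeCluster ζ x) with hFdef
  have hFmono : Monotone F := fun _ _ h => hf (BHK2006.openEdgeCluster_mono h x)
  have hUup : ∀ ω ω' : BondConfig (Fin n), ω ⊆ ω' → ω ∈ U → ω' ∈ U :=
    fun ω ω' hle h => SimpleGraph.Reachable.mono (BHK2006.openGraph_le hle) h
  -- zeroed weights: in `[p₀, 1 − p₀]` on `EY`, zero off `EY`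
  have hq1 : ∀ g ∈ EY, p₀ ≤ ((qY g : unitInterval) : ℝ) ∧ ((qY g : unitInterval) : ℝ) ≤ 1 - p₀ := by
    intro g hg
    obtain ⟨hgE, hgY⟩ := Finset.mem_filter.1 hg
    have hc : ¬ ∃ y ∈ Y, y ∈ g := by
      rintro ⟨y, hy, hyg⟩
      exact hgY y hy hyg
    simp only [hqY]
    rw [if_neg hc]
    exact hE1 g hgE
  have hq0 : ∀ g, g ∉ (↑EY : Set (Sym2 (Fin n))) → ((qY g : unitInterval) : ℝ) = 0 := by
    intro g hg
    simp only [hqY]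
    by_cases hc : ∃ y ∈ Y, y ∈ g
    · rw [if_pos hc]; rfl
    · rw [if_neg hc]
      apply hE0 g
      intro hgE
      exact hg (Finset.mem_coe.2 (Finset.mem_filter.2 ⟨hgE, fun y hy hyg => hc ⟨y, hy, hyg⟩⟩))
  have heEY : e ∈ EY := Finset.mem_filter.2 ⟨heE, heY⟩
  have hR' : R ⊆ EY := fun g hg => Finset.mem_filter.2 ⟨(hR g hg).1, (hR g hg).2.2⟩
  have heR : e ∉ R := fun h => (hR e h).2.1 rfl
  -- restricted functionals (the cylinder hypotheses only speak about configurations inside `EY`)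
  set F' : BondConfig (Fin n) → ℝ := fun ζ => F (ζ ∩ ↑EY) with hF'def
  set u' : BondConfig (Fin n) → ℝ := fun ζ => U.indicator (fun _ => (1 : ℝ)) (ζ ∩ ↑EY) with hu'def
  have hF'mono : Monotone F' := fun ζ ζ' h => hFmono (Set.inter_subset_inter_left _ h)
  have hu'mono : Monotone u' := fun ζ ζ' h => (QuantHarris.indicator_upset_monotone hUup) (Set.inter_subset_inter_left _ h)
  have hF'0 : ∀ ζ, 0 ≤ F' ζ := fun _ => hf0 _
  have hu'0 : ∀ ζ, 0 ≤ u' ζ := fun ζ => Set.indicator_nonneg (fun _ _ => zero_le_one) _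
  have heEYs : e ∈ (↑EY : Set (Sym2 (Fin n))) := Finset.mem_coe.2 heEY
  have hins : ∀ ω : Set (Sym2 (Fin n)), insert e ω ∩ ↑EY = insert e (ω ∩ ↑EY) := fun ω => Set.insert_inter_of_mem heEYs
  have hdif : ∀ ω : Set (Sym2 (Fin n)), (ω \ {e}) ∩ ↑EY = (ω ∩ ↑EY) \ {e} := fun ω => by
    ext g; simp only [Set.mem_inter_iff, Set.mem_sdiff, Set.mem_singleton_iff]; tauto
  have hc₁' : ∀ ω : Set (Sym2 (Fin n)), (∀ g ∈ R₁, (g ∈ ω ↔ g ∈ η₁)) → J ≤ F' (insert e ω) - F' (ω \ {e}) := by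
    intro ω hω
    simp only [hF'def, hFdef, hins, hdif]
    exact hc₁ (ω ∩ ↑EY) Set.inter_subset_right fun g hg =>
      ⟨fun h => (hω g hg).1 h.1, fun h => ⟨(hω g hg).2 h, Finset.mem_coe.2 (hR' (hR₁ hg))⟩⟩
  have hc₂' : ∀ ω : Set (Sym2 (Fin n)), (∀ g ∈ R₂, (g ∈ ω ↔ g ∈ η₂)) → (1 : ℝ) ≤ u' (insert e ω) - u' (ω \ {e}) := by
    intro ω hω
    have h := hc₂ (ω ∩ ↑EY) Set.inter_subset_right fun g hg =>
      ⟨fun h => (hω g hg).1 h.1, fun h => ⟨(hω g hg).2 h, Finset.mem_coe.2 (hR' (hR₂ hg))⟩⟩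
    simp only [hu'def, hins, hdif]
    rw [Set.indicator_of_mem h.1, Set.indicator_of_notMem h.2, sub_zero]
  have hcov0 := QuantHarris.cov_ge_prodPow_cyl_mul_jumps qY EY p₀ hp0.le hq1 F' u' hF'0 hu'0 hF'mono hu'mono
    e heEY R R₁ R₂ hR' hR₁ hR₂ heR η₁ η₂ J 1 hJ zero_le_one hc₁' hc₂'
  rw [mul_one] at hcov0
  -- a.e. `ζ ⊆ EY` under the zeroed measure
  have hae := ae_subset_support qY (↑EY : Set (Sym2 (Fin n))) hq0
  have hEf : (fun ζ => F' ζ * u' ζ) =ᵐ[prodBernoulli qY] fun ζ => F ζ * U.indicator (fun _ => (1 : ℝ)) ζ := by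
    filter_upwards [hae] with ζ hζ
    simp only [hF'def, hu'def, Set.inter_eq_left.2 hζ]
  have hEf1 : F' =ᵐ[prodBernoulli qY] F := by
    filter_upwards [hae] with ζ hζ
    simp only [hF'def, Set.inter_eq_left.2 hζ]
  have hEu1 : u' =ᵐ[prodBernoulli qY] U.indicator (fun _ => (1 : ℝ)) := by
    filter_upwards [hae] with ζ hζ
    simp only [hu'def, Set.inter_eq_left.2 hζ]
  have hcov : (p₀ * (1 - p₀)) ^ (R.card + 1) * J ≤
      ∫ ζ, F ζ * U.indicator (fun _ => (1 : ℝ)) ζ ∂(prodBernoulli qY) -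
        (∫ ζ, F ζ ∂(prodBernoulli qY)) * ∫ ζ, U.indicator (fun _ => (1 : ℝ)) ζ ∂(prodBernoulli qY) := by
    rw [← integral_congr_ae hEf, ← integral_congr_ae hEf1, ← integral_congr_ae hEu1]
    exact hcov0
  have hprod : (fun ζ => F ζ * U.indicator (fun _ => (1 : ℝ)) ζ) = U.indicator F := by
    funext ζ
    by_cases hζ : ζ ∈ U
    · rw [Set.indicator_of_mem hζ, Set.indicator_of_mem hζ, mul_one]
    · rw [Set.indicator_of_notMem hζ, Set.indicator_of_notMem hζ, mul_zero]
  rw [hprod, integral_indicator (hmeas U), integral_indicator (hmeas U)] at hcov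
  simp only [integral_const, smul_eq_mul, mul_one, measureReal_restrict_apply_univ] at hcov
  -- hcov : c ≤ ∫_U F dμ_Y − (∫ F dμ_Y)·μ_Y(U)  (the isolated covariance of `covD_ge_isolated`)
  have hcov' : (p₀ * (1 - p₀)) ^ (R.card + 1) * J ≤
      (∫ ζ in U, F ζ ∂(prodBernoulli qY)) - (∫ ζ, F ζ ∂(prodBernoulli qY)) * (prodBernoulli qY).real U := hcov
  have hD0 : 0 ≤ (prodBernoulli w).real {ω : BondConfig (Fin n) | ∀ y ∈ Y, ¬ (openGraph ω).Reachable x y} := measureReal_nonneg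
  have hP0 : 0 ≤ ∏ g ∈ Finset.univ.filter (fun g : Sym2 (Fin n) => ∃ y ∈ Y, y ∈ g), (1 - (w g : ℝ)) :=
    Finset.prod_nonneg fun g _ => sub_nonneg.2 (w g).2.2
  have hstep := mul_le_mul_of_nonneg_left hcov' (mul_nonneg hD0 hP0)
  simp only [hFdef, hU, hqY] at hstep hiso
  refine le_trans hstep ?_
  convert hiso using 9
  rfl

end CSH

end Summit.CriticalPhenomena.PercolationContinuityZ3.Theorems

end
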